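import Summits.KontsevichZagierPeriods.KontsevichZagierPeriods.Theorems.RootDecompRelativeModAbsoluteCylLogSplitP33

/-! # `RootDecompRelativeModAbsoluteCylLogSplitP34` — part 9/27 of the mechanical ≤400-line split of `RungClosure.lean` (sha256 f909f334226f0fb5…)
Source: decomp-kz lens-3 g12 `RungClosure.lean` v9 (HOME/decomp-kz-lens-3/g12/, sha256 f909f334…; critic g4-52/g4-57/g5 CLEARED, «lander: split v9 --supports 30572»): BLOCK I (57 g11 monolith decls missing from P01–P25), BLOCK II/III (WildCertAssembly parts 1–6, 8–10: `Leaf.cellLocalWildCert`, `Leaf.cylKernelZeroLog_of_trees`), Parts 12–13 (`Leaf.regKernelPairDegOne_iff_circlePos_of_trees`), BLOCK G13 (Möbius engine, test §C decided).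
Split by census-1 g9 `gen/splitlean.py`: scopes re-opened with their `open`/`variable`/`set_option` context; mathematics and declaration order unchanged. -/

noncomputable section
open Set MeasureTheory Filter Topology
open scoped BigOperators
open Literature.NumberTheory.Transcendental Literature.ModelTheory.ExponentialFields
namespace Summit.KontsevichZagierPeriods.RootDecompRelativeModAbsolute.Rung30571
namespace RegularisedLogLayer
namespace CylLog
variable {b : ℕ}

/-- The sign-pattern pieces cover `E` up to the union of the zero sets. -/
theorem diff_iUnion_signPiece_subset {K : ℕ} (E : Set (Fin 1 → ℝ)) (h : Fin K → (Fin 1 → ℝ) → ℝ) :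
    E \ ⋃ ε, signPiece E h ε ⊆ ⋃ k, {x | x ∈ E ∧ h k x = 0} := by
  intro x hx
  rw [Set.mem_sdiff, Set.mem_iUnion] at hx
  obtain ⟨hxE, hxn⟩ := hx
  by_contra hcon
  rw [Set.mem_iUnion] at hcon
  have hne : ∀ k, h k x ≠ 0 := fun k hk => hcon ⟨k, ⟨hxE, hk⟩⟩
  refine hxn ⟨fun k => decide (0 < h k x), hxE, fun k => ?_⟩
  by_cases hk : 0 < h k x
  · simp only [hk, decide_true, if_true]
  · simp only [hk, decide_false, if_false, Bool.false_eq_true]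
    exact lt_of_le_of_ne (not_lt.mp hk) (hne k)

/-- **SIGN-CONDITION LOCALISATION** (the o-minimal triviality behind F1): if the zero sets of the cutting functions are
null, the sign-pattern pieces form a finite partition of `E` up to a null set into OPEN `ℚ`-semialgebraic pieces on
each of which every `h k` keeps a strict sign. -/
theorem volume_diff_iUnion_signPiece {K : ℕ} {E : Set (Fin 1 → ℝ)} {h : Fin K → (Fin 1 → ℝ) → ℝ}
    (hZ : ∀ k, volume {x | x ∈ E ∧ h k x = 0} = 0) : volume (E \ ⋃ ε, signPiece E h ε) = 0 :=
  measure_mono_null (diff_iUnion_signPiece_subset E h) (measure_iUnion_null fun k => hZ k)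

/-- A finite zero set is null (the usual case: a `ℚ`-semialgebraic function of one variable that does not vanish
identically on a subinterval has finitely many zeros). -/
theorem volume_eq_zero_of_finite {S : Set (Fin 1 → ℝ)} (hS : S.Finite) : volume S = 0 :=
  hS.measure_zero volume

/-- `LocalWildCert` from certificates on the sign-pattern pieces. -/
theorem localWildCert_of_signPieces {q K : ℕ} {E : Set (Fin 1 → ℝ)} {c κ : Fin q → (Fin 1 → ℝ) → ℝ}
    {M : Fin q → ℕ} {σ : Fin q → Fin 3} {h : Fin K → (Fin 1 → ℝ) → ℝ}
    (hZ : ∀ k, volume {x | x ∈ E ∧ h k x = 0} = 0)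
    (hloc : ∀ ε, LocalWildCert (signPiece E h ε) c κ M σ) : LocalWildCert E c κ M σ :=
  localWildCert_of_pieces (fun ε => signPiece_subset ε) (pairwise_disjoint_signPiece E h)
    (volume_diff_iUnion_signPiece hZ) hloc

end CylLog

end RegularisedLogLayer

end Summit.KontsevichZagierPeriods.RootDecompRelativeModAbsolute.Rung30571

/-! # BLOCK II — the g11 companions (Parts 1–6 of `WildCertAssembly.lean`, verbatim) -/

namespace Summit.KontsevichZagierPeriods.RootDecompRelativeModAbsolute.Rung30571.RegularisedLogLayer.CylLog.Tame

/-- **Closed form of the fibre integral (the D3 currency conversion `∫ ↦ log`).**  For `κ ≠ 0`, `−1 < κ`: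
`∫₀¹ θ^M/(1+θκ) dθ = (polyLog M (1+κ) + (−1)^M · log (1+κ)) / κ^(M+1)` (substitution `t = 1 + κθ` +
`integral_reg_kernel`). -/
private theorem fibreIntegral_closed_form (M : ℕ) {κ : ℝ} (hκ : κ ≠ 0) (hκ1 : -1 < κ) :
    ∫ θ in Set.Ioo (0:ℝ) 1, θ ^ M / (1 + θ * κ) =
      (polyLog M (1 + κ) + (-1) ^ M * Real.log (1 + κ)) / κ ^ (M + 1) := by
  set ψ : ℝ → ℝ := fun t => (t - 1) ^ M / t with hψ
  have hpt : ∀ θ : ℝ, κ * (ψ (κ * θ + 1) / κ ^ (M + 1)) = θ ^ M / (1 + θ * κ) := by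
    intro θ
    show κ * (((κ * θ + 1 - 1) ^ M / (κ * θ + 1)) / κ ^ (M + 1)) = θ ^ M / (1 + θ * κ)
    rw [add_sub_cancel_right, mul_pow, pow_succ]
    by_cases hden : 1 + θ * κ = 0
    · have h0 : κ * θ + 1 = 0 := by linarith
      rw [h0, hden]
      simp
    · have hden2 : κ * θ + 1 ≠ 0 := fun h => hden (by linarith)
      rw [show (1 : ℝ) + θ * κ = κ * θ + 1 by ring]
      field_simp
  have h1 : ∫ θ in Set.Ioo (0:ℝ) 1, θ ^ M / (1 + θ * κ) = ∫ θ in (0:ℝ)..1, θ ^ M / (1 + θ * κ) := by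
    rw [intervalIntegral.integral_of_le zero_le_one, integral_Ioc_eq_integral_Ioo]
  have h3 : κ * ∫ θ in (0:ℝ)..1, ψ (κ * θ + 1) = ∫ t in κ * 0 + 1..κ * 1 + 1, ψ t :=
    intervalIntegral.mul_integral_comp_mul_add κ 1
  have h4 : ∫ t in (1:ℝ)..1 + κ, ψ t = polyLog M (1 + κ) + (-1) ^ M * Real.log (1 + κ) := by
    rw [hψ, integral_reg_kernel M one_pos (by linarith)]
    simp [polyLog_one]
  rw [h1]
  calc ∫ θ in (0:ℝ)..1, θ ^ M / (1 + θ * κ) = ∫ θ in (0:ℝ)..1, κ * (ψ (κ * θ + 1) / κ ^ (M + 1)) :=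
        intervalIntegral.integral_congr fun θ _ => (hpt θ).symm
    _ = κ * ∫ θ in (0:ℝ)..1, ψ (κ * θ + 1) / κ ^ (M + 1) := intervalIntegral.integral_const_mul κ _
    _ = κ * ((∫ θ in (0:ℝ)..1, ψ (κ * θ + 1)) / κ ^ (M + 1)) := by rw [intervalIntegral.integral_div]
    _ = (κ * ∫ θ in (0:ℝ)..1, ψ (κ * θ + 1)) / κ ^ (M + 1) := by ring
    _ = (∫ t in (1:ℝ)..1 + κ, ψ t) / κ ^ (M + 1) := by
        rw [h3]; simp only [mul_zero, zero_add, mul_one, add_comm]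
    _ = (polyLog M (1 + κ) + (-1) ^ M * Real.log (1 + κ)) / κ ^ (M + 1) := by rw [h4]

/-- LOWER BOUND of the fibre integral: `∫₀¹ θ^M/(1+θκ) dθ ≥ 1/((M+1)(1+|κ|))` (`κ > −1`). -/
theorem fibreIntegral_lb (M : ℕ) {κ : ℝ} (hκ : -1 < κ) :
    1 / (((M:ℝ) + 1) * (1 + |κ|)) ≤ ∫ θ in Set.Ioo (0:ℝ) 1, θ ^ M / (1 + θ * κ) := by
  have hden : ∀ θ ∈ Set.Icc (0:ℝ) 1, 0 < 1 + θ * κ ∧ 1 + θ * κ ≤ 1 + |κ| := by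
    intro θ hθ
    constructor
    · rcases le_or_gt 0 κ with hk | hk
      · nlinarith [hθ.1]
      · nlinarith [hθ.2, hθ.1]
    · have h1 : θ * κ ≤ |κ| := by
        calc θ * κ ≤ |θ * κ| := le_abs_self _
          _ = θ * |κ| := by rw [abs_mul, abs_of_nonneg hθ.1]
          _ ≤ 1 * |κ| := by gcongr; exact hθ.2
          _ = |κ| := one_mul _
      linarith
  have hcont : ContinuousOn (fun θ : ℝ => θ ^ M / (1 + θ * κ)) (Set.Icc 0 1) :=
    ContinuousOn.div (continuousOn_id.pow M) (continuousOn_const.add (continuousOn_id.mul continuousOn_const))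
      fun θ hθ => (hden θ hθ).1.ne'
  have hint : IntegrableOn (fun θ : ℝ => θ ^ M / (1 + θ * κ)) (Set.Ioo 0 1) :=
    (hcont.integrableOn_Icc).mono_set Set.Ioo_subset_Icc_self
  have hconst : IntegrableOn (fun θ : ℝ => θ ^ M / (1 + |κ|)) (Set.Ioo 0 1) :=
    ((continuous_id.pow M).div_const _).integrableOn_Icc.mono_set Set.Ioo_subset_Icc_self
  have hval : ∫ θ in Set.Ioo (0:ℝ) 1, θ ^ M / (1 + |κ|) = 1 / (((M:ℝ) + 1) * (1 + |κ|)) := by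
    rw [integral_div, ← integral_Ioc_eq_integral_Ioo, ← intervalIntegral.integral_of_le zero_le_one,
      integral_pow]
    have hM : ((M:ℝ) + 1) ≠ 0 := by positivity
    have hA : (1 + |κ|) ≠ 0 := by positivity
    field_simp
    simp
  rw [← hval]
  refine setIntegral_mono_on hconst hint measurableSet_Ioo fun θ hθ => ?_
  obtain ⟨h1, h2⟩ := hden θ (Set.Ioo_subset_Icc_self hθ)
  rw [div_eq_mul_one_div (θ ^ M) (1 + θ * κ), div_eq_mul_one_div (θ ^ M) (1 + |κ|)]
  exact mul_le_mul_of_nonneg_left (one_div_le_one_div_of_le h1 h2) (pow_nonneg hθ.1.le M)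

/-- `|k|^i ≤ |k|^M/δ'^M` for `i ≤ M`, `δ' ≤ |k|`, `0 < δ' ≤ 1`. -/
theorem abs_pow_le_of_le {k δ' : ℝ} {i M : ℕ} (hδ0 : 0 < δ') (hδ1 : δ' ≤ 1) (hδk : δ' ≤ |k|) (hi : i ≤ M) :
    |k| ^ i ≤ |k| ^ M / δ' ^ M := by
  rw [le_div_iff₀ (pow_pos hδ0 M)]
  obtain ⟨n, rfl⟩ := Nat.exists_eq_add_of_le hi
  calc |k| ^ i * δ' ^ (i + n) = |k| ^ i * (δ' ^ i * δ' ^ n) := by rw [pow_add]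
    _ ≤ |k| ^ i * (1 * |k| ^ n) := by
        gcongr
        · exact pow_le_one₀ hδ0.le hδ1
    _ = |k| ^ (i + n) := by rw [one_mul, pow_add]

/-- `|polyLog M (1+k)| ≤ M·|k|^M/δ'^M` for `δ' ≤ |k|`, `0 < δ' ≤ 1`. -/
theorem abs_polyLog_one_add_le {k δ' : ℝ} (M : ℕ) (hδ0 : 0 < δ') (hδ1 : δ' ≤ 1) (hδk : δ' ≤ |k|) :
    |polyLog M (1 + k)| ≤ M * (|k| ^ M / δ' ^ M) := by
  unfold polyLog
  refine (Finset.abs_sum_le_sum_abs _ _).trans ?_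
  have hterm : ∀ i ∈ Finset.range M, |(-1:ℝ) ^ (M - 1 - i) * (1 + k - 1) ^ (i + 1) / (i + 1)| ≤
      |k| ^ M / δ' ^ M := by
    intro i hi
    rw [Finset.mem_range] at hi
    rw [add_sub_cancel_left, abs_div, abs_mul, abs_pow, abs_pow, abs_neg, abs_one, one_pow, one_mul,
      abs_of_pos (by positivity : (0:ℝ) < i + 1)]
    calc |k| ^ (i + 1) / (i + 1) ≤ |k| ^ (i + 1) / 1 := by
          gcongr
          · simp
      _ = |k| ^ (i + 1) := div_one _
      _ ≤ |k| ^ M / δ' ^ M := abs_pow_le_of_le hδ0 hδ1 hδk (by omega)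
  refine (Finset.sum_le_sum hterm).trans ?_
  rw [Finset.sum_const, Finset.card_range, nsmul_eq_mul]

/-- DOMINATION ALGEBRA: if `|c| ≤ (M+1)(1+|k|)·|c·I|`, `num ≤ N·|k|^M/δ'^M` and `0 < δ ≤ |k|`, then
`|c|·num/|k|^{M+1} ≤ N(M+1)(1+1/δ)/δ'^M · |c·I|`. -/
theorem dom_alg {c I k δ δ' num N : ℝ} {M : ℕ} (hδ : 0 < δ) (hδk : δ ≤ |k|) (hδ'0 : 0 < δ') (hN : 0 ≤ N)
    (hnum0 : 0 ≤ num) (hnum : num ≤ N * (|k| ^ M / δ' ^ M)) (hc : |c| ≤ ((M:ℝ) + 1) * (1 + |k|) * |c * I|) :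
    |c| * num / |k| ^ (M + 1) ≤ N * ((M:ℝ) + 1) * (1 + 1 / δ) / δ' ^ M * |c * I| := by
  have hk : 0 < |k| := lt_of_lt_of_le hδ hδk
  have hkM : 0 < |k| ^ (M + 1) := pow_pos hk _
  have hd' : 0 < δ' ^ M := pow_pos hδ'0 M
  have h1 : (1 + |k|) / |k| ≤ 1 + 1 / δ := by
    rw [add_div, div_self hk.ne']
    have : 1 / |k| ≤ 1 / δ := one_div_le_one_div_of_le hδ hδk
    linarith
  calc |c| * num / |k| ^ (M + 1)
      ≤ (((M:ℝ) + 1) * (1 + |k|) * |c * I|) * (N * (|k| ^ M / δ' ^ M)) / |k| ^ (M + 1) := by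
        gcongr
    _ = N * ((M:ℝ) + 1) * ((1 + |k|) / |k|) / δ' ^ M * |c * I| := by
        field_simp
        ring
    _ ≤ N * ((M:ℝ) + 1) * (1 + 1 / δ) / δ' ^ M * |c * I| := by
        have hcI : 0 ≤ |c * I| := abs_nonneg _
        have hM : (0:ℝ) ≤ (M:ℝ) + 1 := by positivity
        gcongr

/-- **TAMENESS AWAY FROM `κ = 0`** (F2 of the g12 plan, the ends `κ → L ≠ 0`, `κ → −1⁺`, `κ → +∞` and interior
points): on a measurable piece `C` where `|κ| ≥ δ > 0` (and `κ > −1`), the cylinder integrability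
`c·∫₀¹θ^M/(1+θκ) ∈ L¹(C)` (hypothesis `hL1` of `CellCloseLS` restricted to `C`) forces BOTH tameness conditions of
`TameCell` for this index: `(c/κ^{M+1})·log(1+κ) ∈ L¹(C)` and `(c/κ^{M+1})·κ^{j+1} ∈ L¹(C)` (`j < M`).
Proof: `fibreIntegral_closed_form` + the lower bound `fibreIntegral_lb` + the polynomial bound `abs_polyLog_one_add_le`;
no o-minimality. -/
theorem tame_of_away {C : Set (Fin 1 → ℝ)} (hC : IsSemialgebraic ℚ C) {c κ : (Fin 1 → ℝ) → ℝ}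
    (hc : IsSemialgebraicFunOn ℚ C c) (hκ : IsSemialgebraicFunOn ℚ C κ) (M : ℕ) {δ : ℝ} (hδ : 0 < δ)
    (hκ1 : ∀ x ∈ C, -1 < κ x) (haway : ∀ x ∈ C, δ ≤ |κ x|)
    (hL1 : IntegrableOn (fun x => c x * ∫ θ in Set.Ioo (0:ℝ) 1, θ ^ M / (1 + θ * κ x)) C) :
    IntegrableOn (fun x => c x / κ x ^ (M + 1) * Real.log (1 + κ x)) C ∧
    ∀ j, j < M → IntegrableOn (fun x => c x / κ x ^ (M + 1) * κ x ^ (j + 1)) C := by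
  have hCm : MeasurableSet C := hC.measurableSet_holds
  set δ' : ℝ := min δ 1 with hδ'
  have hδ'0 : 0 < δ' := lt_min hδ one_pos
  have hδ'1 : δ' ≤ 1 := min_le_right _ _
  have hδ'k : ∀ x ∈ C, δ' ≤ |κ x| := fun x hx => (min_le_left _ _).trans (haway x hx)
  have hk0 : ∀ x ∈ C, κ x ≠ 0 := fun x hx h => by
    have := haway x hx; rw [h, abs_zero] at this; linarith
  set I : (Fin 1 → ℝ) → ℝ := fun x => ∫ θ in Set.Ioo (0:ℝ) 1, θ ^ M / (1 + θ * κ x) with hI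
  -- |c| ≤ (M+1)(1+|κ|)|c I|
  have hcI : ∀ x ∈ C, |c x| ≤ ((M:ℝ) + 1) * (1 + |κ x|) * |c x * I x| := by
    intro x hx
    have hlb := fibreIntegral_lb M (hκ1 x hx)
    have hpos : 0 < ((M:ℝ) + 1) * (1 + |κ x|) := by positivity
    have hIpos : 0 < I x := lt_of_lt_of_le (by positivity) hlb
    rw [abs_mul, abs_of_pos hIpos]
    have h1 : 1 ≤ ((M:ℝ) + 1) * (1 + |κ x|) * I x := by
      rw [div_le_iff₀' hpos] at hlb
      simpa using hlb
    calc |c x| = |c x| * 1 := (mul_one _).symm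
      _ ≤ |c x| * (((M:ℝ) + 1) * (1 + |κ x|) * I x) := by gcongr
      _ = ((M:ℝ) + 1) * (1 + |κ x|) * (|c x| * I x) := by ring
  have hd : IsSemialgebraicFunOn ℚ C (fun x => c x / κ x ^ (M + 1)) :=
    IsSemialgebraicFunOn.div hc (isSemialgebraicFunOn_pow' hC hκ (M + 1)) fun x hx => pow_ne_zero _ (hk0 x hx)
  have hdom : Integrable (fun x => |c x * I x|) (volume.restrict C) := hL1.abs
  -- the polynomial part d·polyLog M (1+κ) is integrable
  have h1κ : IsSemialgebraicFunOn ℚ C (fun x => 1 + κ x) :=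
    IsSemialgebraicFunOn.add_holds ((isSemialgebraicFunOn_ratCast hC 1).congr fun _ _ => by simp) hκ
  have hP : IntegrableOn (fun x => c x / κ x ^ (M + 1) * polyLog M (1 + κ x)) C := by
    set A : ℝ := (M:ℝ) * ((M:ℝ) + 1) * (1 + 1 / δ) / δ' ^ M with hA
    refine Integrable.mono' (hdom.const_mul A)
      (KZ.aestronglyMeasurable_of_isSemialgebraicFunOn
        (IsSemialgebraicFunOn.mul_holds hd (isSemialgebraicFunOn_polyLog_comp hC h1κ M)) hCm) ?_
    filter_upwards [ae_restrict_mem hCm] with x hx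
    rw [Real.norm_eq_abs, abs_mul, abs_div, abs_pow, div_mul_eq_mul_div]
    exact dom_alg hδ (haway x hx) hδ'0 (Nat.cast_nonneg M) (abs_nonneg _)
      (abs_polyLog_one_add_le M hδ'0 hδ'1 (hδ'k x hx)) (hcI x hx)
  constructor
  · -- log part: d log(1+κ) = (−1)^M (c I − d polyLog)
    have hsum : IntegrableOn (fun x => (-1:ℝ) ^ M * (c x * I x) - (-1:ℝ) ^ M *
        (c x / κ x ^ (M + 1) * polyLog M (1 + κ x))) C :=
      (hL1.const_mul _).sub (hP.const_mul _)
    refine IntegrableOn.congr_fun hsum (fun x hx => ?_) hCm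
    have hk := hk0 x hx
    have hcl := fibreIntegral_closed_form M hk (hκ1 x hx)
    simp only [hI] at hcl ⊢
    rw [hcl]
    have hsq : ((-1:ℝ) ^ M) * ((-1:ℝ) ^ M) = 1 := by
      rw [← mul_pow, neg_one_mul, neg_neg, one_pow]
    field_simp
    linear_combination (c x * Real.log (1 + κ x)) * hsq
  · intro j hj
    set A : ℝ := (1:ℝ) * ((M:ℝ) + 1) * (1 + 1 / δ) / δ' ^ M with hA
    refine Integrable.mono' (hdom.const_mul A)
      (KZ.aestronglyMeasurable_of_isSemialgebraicFunOn
        (IsSemialgebraicFunOn.mul_holds hd (isSemialgebraicFunOn_pow' hC hκ (j + 1))) hCm) ?_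
    filter_upwards [ae_restrict_mem hCm] with x hx
    rw [Real.norm_eq_abs, abs_mul, abs_div, abs_pow, abs_pow, div_mul_eq_mul_div]
    refine dom_alg hδ (haway x hx) hδ'0 zero_le_one (pow_nonneg (abs_nonneg _) _) ?_ (hcI x hx)
    rw [one_mul]
    exact abs_pow_le_of_le hδ'0 hδ'1 (hδ'k x hx) (by omega)

/-- **Coefficients are integrable where `κ` is bounded**: `|κ| ≤ B` on the piece and `c·∫₀¹θ^M/(1+θκ) ∈ L¹` give
`c ∈ L¹` (by `fibreIntegral_lb`).  Used at a `κᵢ → 0` end (F3: the clauses `hZpow`, and `cₖ ∈ L¹` for the torus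
honesty bounds). -/
theorem integrableOn_coeff_of_abs_le {C : Set (Fin 1 → ℝ)} (hC : IsSemialgebraic ℚ C) {c κ : (Fin 1 → ℝ) → ℝ}
    (hc : IsSemialgebraicFunOn ℚ C c) (M : ℕ) {B : ℝ} (hκ1 : ∀ x ∈ C, -1 < κ x) (hB : ∀ x ∈ C, |κ x| ≤ B)
    (hL1 : IntegrableOn (fun x => c x * ∫ θ in Set.Ioo (0:ℝ) 1, θ ^ M / (1 + θ * κ x)) C) :
    IntegrableOn c C := by
  have hCm : MeasurableSet C := hC.measurableSet_holds
  set I : (Fin 1 → ℝ) → ℝ := fun x => ∫ θ in Set.Ioo (0:ℝ) 1, θ ^ M / (1 + θ * κ x) with hI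
  refine Integrable.mono' ((hL1.abs).const_mul (((M:ℝ) + 1) * (1 + B)))
    (KZ.aestronglyMeasurable_of_isSemialgebraicFunOn hc hCm) ?_
  filter_upwards [ae_restrict_mem hCm] with x hx
  have hlb := fibreIntegral_lb M (hκ1 x hx)
  have hpos : 0 < ((M:ℝ) + 1) * (1 + |κ x|) := by positivity
  have hIpos : 0 < I x := lt_of_lt_of_le (by positivity) hlb
  rw [Real.norm_eq_abs]
  show |c x| ≤ ((M:ℝ) + 1) * (1 + B) * |c x * I x|
  rw [abs_mul, abs_of_pos hIpos]
  have h1 : 1 ≤ ((M:ℝ) + 1) * (1 + |κ x|) * I x := by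
    rw [div_le_iff₀' hpos] at hlb
    simpa using hlb
  have hBx := hB x hx
  calc |c x| = |c x| * 1 := (mul_one _).symm
    _ ≤ |c x| * (((M:ℝ) + 1) * (1 + |κ x|) * I x) := by gcongr
    _ ≤ |c x| * (((M:ℝ) + 1) * (1 + B) * I x) := by
        have hcx : 0 ≤ |c x| := abs_nonneg _
        have hIx : 0 ≤ I x := hIpos.le
        gcongr
    _ = ((M:ℝ) + 1) * (1 + B) * (|c x| * I x) := by ring

/-- **Regularised coefficients are integrable away from `κ = 0`**: `|κ| ≥ δ > 0` on the piece and `c·∫₀¹θ^M/(1+θκ) ∈ L¹`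
give `d = c/κ^{M+1} ∈ L¹` (also at a `κ → +∞` end).  Used in F3: the MIXED part of the relation lattice has coefficients
that are `ℚ`-combinations of these tame `dₖ` (see the g11 memo, addendum 5). -/
theorem integrableOn_regCoeff_of_away {C : Set (Fin 1 → ℝ)} (hC : IsSemialgebraic ℚ C) {c κ : (Fin 1 → ℝ) → ℝ}
    (hc : IsSemialgebraicFunOn ℚ C c) (hκ : IsSemialgebraicFunOn ℚ C κ) (M : ℕ) {δ : ℝ} (hδ : 0 < δ)
    (hκ1 : ∀ x ∈ C, -1 < κ x) (haway : ∀ x ∈ C, δ ≤ |κ x|)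
    (hL1 : IntegrableOn (fun x => c x * ∫ θ in Set.Ioo (0:ℝ) 1, θ ^ M / (1 + θ * κ x)) C) :
    IntegrableOn (fun x => c x / κ x ^ (M + 1)) C := by
  have hCm : MeasurableSet C := hC.measurableSet_holds
  set δ' : ℝ := min δ 1 with hδ'
  have hδ'0 : 0 < δ' := lt_min hδ one_pos
  have hδ'1 : δ' ≤ 1 := min_le_right _ _
  have hδ'k : ∀ x ∈ C, δ' ≤ |κ x| := fun x hx => (min_le_left _ _).trans (haway x hx)
  have hk0 : ∀ x ∈ C, κ x ≠ 0 := fun x hx h => by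
    have := haway x hx; rw [h, abs_zero] at this; linarith
  set I : (Fin 1 → ℝ) → ℝ := fun x => ∫ θ in Set.Ioo (0:ℝ) 1, θ ^ M / (1 + θ * κ x) with hI
  have hcI : ∀ x ∈ C, |c x| ≤ ((M:ℝ) + 1) * (1 + |κ x|) * |c x * I x| := by
    intro x hx
    have hlb := fibreIntegral_lb M (hκ1 x hx)
    have hpos : 0 < ((M:ℝ) + 1) * (1 + |κ x|) := by positivity
    have hIpos : 0 < I x := lt_of_lt_of_le (by positivity) hlb
    rw [abs_mul, abs_of_pos hIpos]
    have h1 : 1 ≤ ((M:ℝ) + 1) * (1 + |κ x|) * I x := by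
      rw [div_le_iff₀' hpos] at hlb
      simpa using hlb
    calc |c x| = |c x| * 1 := (mul_one _).symm
      _ ≤ |c x| * (((M:ℝ) + 1) * (1 + |κ x|) * I x) := by gcongr
      _ = ((M:ℝ) + 1) * (1 + |κ x|) * (|c x| * I x) := by ring
  have hd : IsSemialgebraicFunOn ℚ C (fun x => c x / κ x ^ (M + 1)) :=
    IsSemialgebraicFunOn.div hc (isSemialgebraicFunOn_pow' hC hκ (M + 1)) fun x hx => pow_ne_zero _ (hk0 x hx)
  set A : ℝ := (1:ℝ) * ((M:ℝ) + 1) * (1 + 1 / δ) / δ' ^ M with hA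
  refine Integrable.mono' ((hL1.abs).const_mul A) (KZ.aestronglyMeasurable_of_isSemialgebraicFunOn hd hCm) ?_
  filter_upwards [ae_restrict_mem hCm] with x hx
  rw [Real.norm_eq_abs, abs_div, abs_pow]
  have h := dom_alg (num := 1) hδ (haway x hx) hδ'0 zero_le_one zero_le_one ?_ (hcI x hx)
  · simpa only [mul_one] using h
  · rw [one_mul, le_div_iff₀ (pow_pos hδ'0 M), one_mul]
    exact pow_le_pow_left₀ hδ'0.le (hδ'k x hx) M

/-- **`M = 0` indices are ALWAYS log-tame**: `(c/κ)·log(1+κ) = c·∫₀¹dθ/(1+θκ)` pointwise (`κ ≠ 0`), so the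
log condition of `TameCell` IS `hL1`; the power condition is vacuous for `M = 0`. -/
theorem tameLog_of_M_eq_zero {C : Set (Fin 1 → ℝ)} (hCm : MeasurableSet C) {c κ : (Fin 1 → ℝ) → ℝ} {M : ℕ}
    (hM : M = 0) (hk0 : ∀ x ∈ C, κ x ≠ 0) (hκ1 : ∀ x ∈ C, -1 < κ x)
    (hL1 : IntegrableOn (fun x => c x * ∫ θ in Set.Ioo (0:ℝ) 1, θ ^ M / (1 + θ * κ x)) C) :
    IntegrableOn (fun x => c x / κ x ^ (M + 1) * Real.log (1 + κ x)) C := by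
  subst hM
  refine IntegrableOn.congr_fun hL1 (fun x hx => ?_) hCm
  have hk := hk0 x hx
  rw [fibreIntegral_closed_form 0 hk (hκ1 x hx), polyLog_zero]
  simp only [pow_zero, one_mul, zero_add, pow_one]
  field_simp

end Summit.KontsevichZagierPeriods.RootDecompRelativeModAbsolute.Rung30571.RegularisedLogLayer.CylLog.Tame
end
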